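import Summits.AnomalousDissipation.AnomalousDissipation.Theorems.SolenoidalFractalHomogenisationLagrangianStepWCrossingWindow
import Summits.AnomalousDissipation.AnomalousDissipation.Theorems.SolenoidalFractalHomogenisationLagrangianStepCellLawVEvenSlotStep
import Summits.AnomalousDissipation.AnomalousDissipation.Theorems.IsotropicCubatureWord
import HarnessLib

/-!
# K1L_D IS-half · E1-CERT v2 port, part 1/5: certificate DATA, the centre `Sc`, the invariant and per-slot coordinate forms (definitions + finite algebra)

Summits-side PORT (prover seat `ad-sawtooth-k1loc-p1` g12; tenure E1-LAND 2026-08-29T00:31:55Z) of planner ad-ideate-p5 g12's certificate spine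
`Cruxes/LagrangianRenormalisationStep/Lines/onelevel_W_evenSlack_cert.lean` v2 (commit 88965dfa39cf; the mathematics, the numerics `evencert.py` / kit j321011
and the custody `HOME/ad-ideate-p5/k1l-even-cert/` are p5's) for the IS-half obligation `stub_W_evenSlackB : ∃ a > 0, WCrossing.EvenSlackWindowB a WCrossing.ρB`
of K1L_D `stub_cellLawV0_IS` (stmt-AnomalousDissipation-27980).  The port states everything over the LANDED `WCrossing` definitions
(`…LagrangianStepWCrossing`, prover ad-k1loc-p3 g7) instead of the spine's §W copies and wires the spine's three analytic stubs to landed theorems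
(`stub_oddEven ↦ oddEven_qsResp` p681750, `stub_N110U/L ↦ encl_N110U/L` p682297, point enclosures `↦ encl_N1xx` p681405); texts otherwise VERBATIM
(namespace `…LagrangianStep.WEvenCert`).  NOT a proof of `stub_cellLawV0_IS`, of the crux K1L_D, of Onsager's conjecture or of anomalous dissipation;
rung leaf F-D1.A0.

Part 1: §0 certificate constants (exact rationals), §1 `Sc = isoVisc 1 + κc•Δ4` and the `O_h`-invariant forms `I₁, I₂, I₃`, §2 per-slot coordinate forms and the 26-slot sums (`slot_sum_poly`), plus the definitions of §3 hoisted here (`symS`, `T100/T110/T111/β111`, `nj`, `Tj`, `mdot`, `nsq`, `I1m`, `zv`, `zd`, `dd`) so that parts 2–5 are proof-only.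
-/

set_option linter.dupNamespace false

noncomputable section

namespace Summit.AnomalousDissipation.AnomalousDissipation.Theorems.SolenoidalFractalHomogenisation.LagrangianStep.WEvenCert

open Summit.AnomalousDissipation.AnomalousDissipation.Theorems
open Summit.AnomalousDissipation.AnomalousDissipation.Theorems.SolenoidalFractalHomogenisation.LagrangianStep
open Summit.AnomalousDissipation.AnomalousDissipation.Theorems.SolenoidalFractalHomogenisation.LagrangianStep.WCrossing
open Literature.Analysis Literature.Analysis.FluidPDE Literature.Analysis.FunctionSpaces
open Literature.Algebra.EuclideanLattices (norm_sq_fin_three)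
open Set Real

/-! ## §0 Certificate data (exact rationals; `evencert.py`, kit j321011, τ₀ = 1/200, flat sectorial charge ℓ̄ = 10⁻⁵, directed rounding to 10⁻¹⁰ plus a deliberate slack σ = 10⁻⁷ on every enclosure) -/

/-- centre anisotropy `κ̃` (rounded fixed point of the `O_h`-invariant power iteration). -/
def κc : ℝ := (-15851083 : ℝ) / 5000000000
/-- reduced normalisation `â = a/(2(2π)⁴·3720)`. -/
def aHat : ℝ := (8946415019 : ℝ) / 500000000000
/-- the normalisation `a` of `ΦB a`. -/
def aB : ℝ := aHat * (2 * (2 * π) ^ 4 * 3720)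
/-- the soft eigenvalue `β_d = 1 + κc/2` of the {110} centre block `diag(1, β_d)` (also `= sloC`). -/
def βd : ℝ := 1 + κc / 2
/-- 1-D ENCLOSURE CONSTANTS (the six `stub_N…` below; memo §2; each an outward 10⁻¹⁰-rounding with deliberate slack 10⁻⁷ of a closed-form value of
`f_c(x) = qsRespScalar ½ T_c x = ϑ(½, T_c x)/x`, `T_c = 4π²|m_c|²·M_B·τ_c ∈ {31.58, 202.13, 575.60}`):
UPPER `U100p ≥ f₁₀₀(1/λ₀)`, `U111p ≥ f₁₁₁(β₁₁₁/λ₀)` (`β₁₁₁ = 1 + κc/3`), {110} tangent majorant `f₁₁₀(1/(λ₀u)) ≤ UAp + UB·u` on `u ∈ [0.83, 1.002]`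
(`u ↦ f(1/(λ₀u)) = λ₀u·ϑ(T/(λ₀u))` is concave); LOWER `L100p ≤ λ₀f₁₀₀(λ₀)`, `L111p ≤ λ₀f₁₁₁(λ₀β₁₁₁)`, {110} tangent minorant
`LAp + LB·x ≤ λ₀ f₁₁₀(λ₀x)` on `x ∈ [0.83, 1]` (convex).  `ellBar = 10⁻⁵ ≥ τ₀²Λ_w⁵/(4 slo³)` is the flat SECTORIAL CHARGE (`stub_oddEven`). -/
def ellBar : ℝ := (1 : ℝ) / 100000
/-- `U100p` (E1-CERT v2 spine §0–§2, p5 g12). -/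
def U100p : ℝ := (3426015147 : ℝ) / 10000000000
/-- `L100p` (E1-CERT v2 spine §0–§2, p5 g12). -/
def L100p : ℝ := (3299642599 : ℝ) / 10000000000
/-- `U111p` (E1-CERT v2 spine §0–§2, p5 g12). -/
def U111p : ℝ := (867549851 : ℝ) / 2500000000
/-- `L111p` (E1-CERT v2 spine §0–§2, p5 g12). -/
def L111p : ℝ := (667349421 : ℝ) / 2000000000
/-- `UAp` (E1-CERT v2 spine §0–§2, p5 g12). -/
def UAp : ℝ := (431533 : ℝ) / 2000000000
/-- `UB` (E1-CERT v2 spine §0–§2, p5 g12). -/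
def UB : ℝ := (865856429 : ℝ) / 2500000000
/-- `LAp` (E1-CERT v2 spine §0–§2, p5 g12). -/
def LAp : ℝ := (1667097253 : ℝ) / 2500000000
/-- `LB` (E1-CERT v2 spine §0–§2, p5 g12). -/
def LB : ℝ := (-1667975517 : ℝ) / 5000000000
/-- window numbers: `λ₀ = Λc`, `Λ_V`, `slo = 1 + κc/2`, `shi = 1`, `Λ = Λ_w = Λ_V λ₀ shi/slo`, `δ`, `τ₀`. -/
def lam0 : ℝ := 26 / 25
/-- `LamV` (E1-CERT v2 spine §0–§2, p5 g12). -/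
def LamV : ℝ := 21 / 20
/-- `sloC` (E1-CERT v2 spine §0–§2, p5 g12). -/
def sloC : ℝ := (9984148917 : ℝ) / 10000000000
/-- `LamW` (E1-CERT v2 spine §0–§2, p5 g12). -/
def LamW : ℝ := (3640000000 : ℝ) / 3328049639
/-- `δc` (E1-CERT v2 spine §0–§2, p5 g12). -/
def δc : ℝ := 1 / 8000
/-- `τ0c` (E1-CERT v2 spine §0–§2, p5 g12). -/
def τ0c : ℝ := 1 / 200
/-- PRIMARY CLASS CONSTANTS of the per-slot bounds (`slot_upper`/`slot_lower`): the enclosure constants charged with the sectorial loss,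
`U_c = U_c' + ℓ̄`, `L_c = L_c' − Λ_w ℓ̄`. -/
def U100 : ℝ := U100p + ellBar
/-- `U111` (E1-CERT v2 spine §0–§2, p5 g12). -/
def U111 : ℝ := U111p + ellBar
/-- `UA` (E1-CERT v2 spine §0–§2, p5 g12). -/
def UA : ℝ := UAp + ellBar
/-- `L100` (E1-CERT v2 spine §0–§2, p5 g12). -/
def L100 : ℝ := L100p - LamW * ellBar
/-- `L111` (E1-CERT v2 spine §0–§2, p5 g12). -/
def L111 : ℝ := L111p - LamW * ellBar
/-- `LA` (E1-CERT v2 spine §0–§2, p5 g12). -/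
def LA : ℝ := LAp - LamW * ellBar
/-- DERIVED per-class coefficients of the per-slot forms (`uForm`/`lForm` below): `|P p|²`-coefficients per unit `PpM/M` and the {110} `Z`-coefficient.
{100}: `U100·|Pp|²`; {110}: `UA|Pp|² + UB·(p_z² + p_d²/β_d) = ((UA + UB/β_d)/2)·PpM + UB(1 − 1/β_d)·Z`; {111}: `U111·|Pp|² = (U111/3)·PpM`
(lower: `LA|Pp|² + LB·(p_z² + β_d p_d²)`, etc.). -/
def qA1 : ℝ := U100
/-- `qA2` (E1-CERT v2 spine §0–§2, p5 g12). -/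
def qA2 : ℝ := (UA + UB / βd) / 2
/-- `qA3` (E1-CERT v2 spine §0–§2, p5 g12). -/
def qA3 : ℝ := U111 / 3
/-- `qB2` (E1-CERT v2 spine §0–§2, p5 g12). -/
def qB2 : ℝ := UB * (1 - 1 / βd)
/-- `lA1` (E1-CERT v2 spine §0–§2, p5 g12). -/
def lA1 : ℝ := L100
/-- `lA2` (E1-CERT v2 spine §0–§2, p5 g12). -/
def lA2 : ℝ := (LA + LB * βd) / 2
/-- `lA3` (E1-CERT v2 spine §0–§2, p5 g12). -/
def lA3 : ℝ := L111 / 3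
/-- `lB2` (E1-CERT v2 spine §0–§2, p5 g12). -/
def lB2 : ℝ := LB * (1 - βd)
/-- invariant coefficients of the 26-slot sums (linear in the class constants, `slot_sum_poly`). -/
def u1 : ℝ := 80 * qA1 + 192 * qA2 + 144 * qA3 + 64 * qB2
/-- `u2` (E1-CERT v2 spine §0–§2, p5 g12). -/
def u2 : ℝ := 40 * qA1 + 160 * qA2 + 144 * qA3 + 32 * qB2
/-- `u3` (E1-CERT v2 spine §0–§2, p5 g12). -/
def u3 : ℝ := 64 * qA2 + 72 * qA3
/-- `l1` (E1-CERT v2 spine §0–§2, p5 g12). -/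
def l1 : ℝ := 80 * lA1 + 192 * lA2 + 144 * lA3 + 64 * lB2
/-- `l2` (E1-CERT v2 spine §0–§2, p5 g12). -/
def l2 : ℝ := 40 * lA1 + 160 * lA2 + 144 * lA3 + 32 * lB2
/-- `l3` (E1-CERT v2 spine §0–§2, p5 g12). -/
def l3 : ℝ := 64 * lA2 + 72 * lA3

/-- `aHat_pos` (E1-CERT v2 spine §0–§2, p5 g12). -/
theorem aHat_pos : 0 < aHat := by unfold aHat; norm_num
/-- `aB_pos` (E1-CERT v2 spine §0–§2, p5 g12). -/
theorem aB_pos : 0 < aB := by unfold aB; have := aHat_pos; positivity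
/-- `lam0_pos` (E1-CERT v2 spine §0–§2, p5 g12). -/
theorem lam0_pos : 0 < lam0 := by unfold lam0; norm_num
/-- `sloC_eq` (E1-CERT v2 spine §0–§2, p5 g12). -/
theorem sloC_eq : sloC = 1 + κc / 2 := by unfold sloC κc; norm_num
/-- `βd_eq_sloC` (E1-CERT v2 spine §0–§2, p5 g12). -/
theorem βd_eq_sloC : βd = sloC := by rw [sloC_eq]; rfl

/-! ## §1 The centre `Sc` and the invariant forms -/

/-- `Δ4 i a j b = [i = a = j = b]` (the cubic fourth-order invariant). -/
def Δ4 : T4 := fun i a j b => if i = a ∧ i = j ∧ i = b then 1 else 0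

/-- THE CENTRE: `Sc = I + κc Δ4` (O_h-invariant; blocks `I₂` on {100}, `(1+κc/3) I₂` on {111}, `diag(1, 1+κc/2)` on {110}). -/
def Sc : T4 := Torus.isoVisc 1 + κc • Δ4

/-- `|k|²|p|²`. -/
def Nkp (k p : Fin 3 → ℝ) : ℝ := (k 0 ^ 2 + k 1 ^ 2 + k 2 ^ 2) * (p 0 ^ 2 + p 1 ^ 2 + p 2 ^ 2)
/-- `I₁ = Σ_c k_c² p_c²`. -/
def I1 (k p : Fin 3 → ℝ) : ℝ := k 0 ^ 2 * p 0 ^ 2 + k 1 ^ 2 * p 1 ^ 2 + k 2 ^ 2 * p 2 ^ 2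
/-- `I₂ = Σ_{a ≠ b} k_a² p_b²`. -/
def I2 (k p : Fin 3 → ℝ) : ℝ := k 0 ^ 2 * (p 1 ^ 2 + p 2 ^ 2) + k 1 ^ 2 * (p 0 ^ 2 + p 2 ^ 2) + k 2 ^ 2 * (p 0 ^ 2 + p 1 ^ 2)
/-- `I₃ = Σ_{a ≠ b} k_a k_b p_a p_b`. -/
def I3 (k p : Fin 3 → ℝ) : ℝ := 2 * (k 0 * k 1 * p 0 * p 1 + k 0 * k 2 * p 0 * p 2 + k 1 * k 2 * p 1 * p 2)

/-- `Nkp_eq` (E1-CERT v2 spine §0–§2, p5 g12). -/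
theorem Nkp_eq (k p : Fin 3 → ℝ) : Nkp k p = I1 k p + I2 k p := by unfold Nkp I1 I2; ring
/-- `I1_nonneg` (E1-CERT v2 spine §0–§2, p5 g12). -/
theorem I1_nonneg (k p : Fin 3 → ℝ) : 0 ≤ I1 k p := by unfold I1; positivity
/-- `I2_nonneg` (E1-CERT v2 spine §0–§2, p5 g12). -/
theorem I2_nonneg (k p : Fin 3 → ℝ) : 0 ≤ I2 k p := by unfold I2; positivity
/-- `Nkp_nonneg` (E1-CERT v2 spine §0–§2, p5 g12). -/
theorem Nkp_nonneg (k p : Fin 3 → ℝ) : 0 ≤ Nkp k p := by unfold Nkp; positivity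

/-- `dot_eq` (E1-CERT v2 spine §0–§2, p5 g12). -/
theorem dot_eq {k p : Fin 3 → ℝ} (h : ∑ i, p i * k i = 0) : p 0 * k 0 + p 1 * k 1 + p 2 * k 2 = 0 := by
  simpa [Fin.sum_univ_three] using h

/-- On transverse pairs `I₃ = −I₁` (since `I₁ + I₃ = (k·p)²`). [folklore] -/
theorem I3_eq_of_perp {k p : Fin 3 → ℝ} (h : ∑ i, p i * k i = 0) : I3 k p = -I1 k p := by
  have h0 := dot_eq h
  have e : I1 k p + I3 k p = (p 0 * k 0 + p 1 * k 1 + p 2 * k 2) ^ 2 := by unfold I1 I3; ring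
  rw [h0] at e; linarith [e, sq_nonneg (0:ℝ)]

/-- On transverse pairs `I₁ ≤ I₂` (`I₂ − I₁ = Σ_{a<b}(k_a p_b + k_b p_a)² − (k·p)²`). [folklore] -/
theorem I1_le_I2_of_perp {k p : Fin 3 → ℝ} (h : ∑ i, p i * k i = 0) : I1 k p ≤ I2 k p := by
  have h0 := dot_eq h
  have e : I2 k p - I1 k p = (k 0 * p 1 + k 1 * p 0) ^ 2 + (k 0 * p 2 + k 2 * p 0) ^ 2 + (k 1 * p 2 + k 2 * p 1) ^ 2
      - (p 0 * k 0 + p 1 * k 1 + p 2 * k 2) ^ 2 := by unfold I1 I2; ring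
  rw [h0] at e; nlinarith [e, sq_nonneg (k 0 * p 1 + k 1 * p 0), sq_nonneg (k 0 * p 2 + k 2 * p 0), sq_nonneg (k 1 * p 2 + k 2 * p 1)]

/-- `symb Δ4 (k,p) = I₁`. [folklore] -/
theorem symb_Δ4 (k p : Fin 3 → ℝ) : Torus.symb Δ4 k p = I1 k p := by
  unfold Torus.symb Δ4 I1
  simp [Fin.sum_univ_three]
  ring

/-- `symb Sc (k,p) = |k|²|p|² + κc I₁`. [folklore] -/
theorem symb_Sc (k p : Fin 3 → ℝ) : Torus.symb Sc k p = Nkp k p + κc * I1 k p := by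
  rw [Sc, Torus.symb_add, Torus.symb_smul, Torus.symb_isoVisc, symb_Δ4]
  simp [Fin.sum_univ_three, Nkp]

/-- `sloC·|k|²|p|² ≤ symb Sc ≤ |k|²|p|²` on transverse pairs (`κc < 0`, `0 ≤ I₁ ≤ |k|²|p|²/2`). [folklore] -/
theorem symb_Sc_bounds {k p : Fin 3 → ℝ} (h : ∑ i, p i * k i = 0) :
    sloC * Nkp k p ≤ Torus.symb Sc k p ∧ Torus.symb Sc k p ≤ Nkp k p := by
  rw [symb_Sc, sloC_eq, Nkp_eq]
  have h1 := I1_nonneg k p; have h2 := I1_le_I2_of_perp h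
  have hκ : κc < 0 := by unfold κc; norm_num
  constructor <;> nlinarith

/-- `NearIso Sc sloC 1`. [folklore] -/
theorem nearIso_Sc : Torus.NearIso Sc sloC 1 := by
  intro k p h
  have hb := symb_Sc_bounds h
  have hN : (∑ a, k a ^ 2) * (∑ i, p i ^ 2) = Nkp k p := by simp [Fin.sum_univ_three, Nkp]
  rw [hN]; exact ⟨hb.1, by linarith [hb.2]⟩

/-- `Sc/λ₀ ≼ I ≼ λ₀ Sc`. [folklore] -/
theorem inInterval_Sc_iso : InInterval Sc lam0 (Torus.isoVisc 1) := by
  constructor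
  · intro k p h
    rw [Torus.symb_smul, Torus.symb_isoVisc]
    have hb := symb_Sc_bounds h
    have hN : (∑ a, k a ^ 2) * (∑ i, p i ^ 2) = Nkp k p := by simp [Fin.sum_univ_three, Nkp]
    rw [hN]
    have hN0 := Nkp_nonneg k p
    have : 1 / lam0 * Torus.symb Sc k p ≤ Torus.symb Sc k p := by
      rw [div_mul_eq_mul_div, one_mul, div_le_iff₀ lam0_pos]; unfold lam0; nlinarith [hb.1, hb.2, show (0:ℝ) < sloC by unfold sloC; norm_num]
    linarith [hb.2]
  · intro k p h
    rw [Torus.symb_smul, Torus.symb_isoVisc]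
    have hb := symb_Sc_bounds h
    have hN : (∑ a, k a ^ 2) * (∑ i, p i ^ 2) = Nkp k p := by simp [Fin.sum_univ_three, Nkp]
    rw [hN]
    have hN0 := Nkp_nonneg k p
    have hls : 1 ≤ lam0 * sloC := by unfold lam0 sloC; norm_num
    have h1 := mul_le_mul_of_nonneg_left hb.1 lam0_pos.le
    have h2 := mul_le_mul_of_nonneg_right hls hN0
    nlinarith [h1, h2]

/-! ## §2 Per-slot coordinate forms (integer slot data of `cubatureWord`) -/

/-- `M = |m|²`. -/
def Mq (d : SlotData) : ℝ := (d.m 0 : ℝ) ^ 2 + (d.m 1 : ℝ) ^ 2 + (d.m 2 : ℝ) ^ 2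
/-- `M·|P_m p|² = M|p|² − (m·p)²`. -/
def PpM (d : SlotData) (p : Fin 3 → ℝ) : ℝ :=
  Mq d * (p 0 ^ 2 + p 1 ^ 2 + p 2 ^ 2) - (p 0 * d.m 0 + p 1 * d.m 1 + p 2 * d.m 2) ^ 2
/-- `Z = Σ_c (m_{c+1} m_{c+2})² p_c²` (face diagonal: the square of the component of `p` along the coordinate axis `⊥ m`). -/
def Zf (d : SlotData) (p : Fin 3 → ℝ) : ℝ :=
  ((d.m 1 : ℝ) * d.m 2) ^ 2 * p 0 ^ 2 + ((d.m 2 : ℝ) * d.m 0) ^ 2 * p 1 ^ 2 + ((d.m 0 : ℝ) * d.m 1) ^ 2 * p 2 ^ 2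
/-- the reduced k-side slot coefficient `τ (v·k)²/(n M²)` (`= slotCoef·(e·k)²·2(2π)⁴·3720`, `slotCoef_mul_sq`). -/
def kCoef (d : SlotData) (k : Fin 3 → ℝ) : ℝ :=
  (d.τ : ℝ) * ((d.v 0 : ℝ) * k 0 + d.v 1 * k 1 + d.v 2 * k 2) ^ 2 / (d.n * Mq d ^ 2)
/-- Lagrange interpolation of the three class constants in `M ∈ {1,2,3}`. -/
def qLag (A1 A2 A3 x : ℝ) : ℝ := A1 * ((x - 2) * (x - 3) / 2) - A2 * ((x - 1) * (x - 3)) + A3 * ((x - 1) * (x - 2) / 2)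
/-- UPPER per-slot form (bounds `λ₀/λ · pᵀQ_s p`). -/
def uForm (d : SlotData) (p : Fin 3 → ℝ) : ℝ :=
  qLag qA1 qA2 qA3 (Mq d) * PpM d p + qB2 * ((Mq d - 1) * (3 - Mq d)) * Zf d p
/-- LOWER per-slot form (bounded by `λ · pᵀQ_s p`). -/
def lForm (d : SlotData) (p : Fin 3 → ℝ) : ℝ :=
  qLag lA1 lA2 lA3 (Mq d) * PpM d p + lB2 * ((Mq d - 1) * (3 - Mq d)) * Zf d p

/-- Pure algebra behind `slotCoef_mul_sq`. -/
theorem coef_algebra (τ r M sn n S c : ℝ) (hr : r ^ 2 = M) (hM : 0 < M) (hsn : sn ^ 2 = n) (hn : 0 < n) (hc : 0 < c) :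
    τ / (2 * (c * r) ^ 4) / 3720 * ((1 / sn) * S) ^ 2 = τ * S ^ 2 / (n * M ^ 2) / (2 * c ^ 4 * 3720) := by
  have hr0 : r ≠ 0 := by rintro rfl; simp at hr; linarith
  have hsn0 : sn ≠ 0 := by rintro rfl; simp at hsn; linarith
  have hr4 : r ^ 4 = M ^ 2 := by rw [← hr]; ring
  have e1 : (c * r) ^ 4 = c ^ 4 * M ^ 2 := by rw [mul_pow, hr4]
  have e2 : ((1 / sn) * S) ^ 2 = S ^ 2 / n := by rw [mul_pow, one_div, inv_pow, hsn]; ring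
  rw [e1, e2]
  field_simp

/-- The k-side coefficient of a slot of the cubature word in closed form:
`slotCoef_s · (e_s·k)² = τ_s (v_s·k)²/(n_s M_s²) / (2(2π)⁴·3720)`. [folklore] -/
theorem slotCoef_mul_sq (j : Fin 26) (k : Fin 3 → ℝ) :
    slotCoef cubatureWord j * (∑ a, (cubatureWord.phase j).e a * k a) ^ 2 = kCoef (slots j) k / (2 * (2 * π) ^ 4 * 3720) := by
  have h := slots_ok j
  have hn : (0 : ℝ) < (slots j).n := by exact_mod_cast h.2.1
  have hM2 : ‖Torus.latticeVec (slots j).m‖ ^ 2 = Mq (slots j) := by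
    rw [norm_sq_fin_three]; simp only [Torus.latticeVec_apply, Mq]
  have hMpos : 0 < Mq (slots j) := by
    unfold Mq
    rcases h.1 with h0 | h0 | h0
    · have : (0:ℝ) < ((slots j).m 0 : ℝ) ^ 2 := by
        have : ((slots j).m 0 : ℝ) ≠ 0 := by exact_mod_cast h0
        positivity
      nlinarith [sq_nonneg ((slots j).m 1 : ℝ), sq_nonneg ((slots j).m 2 : ℝ)]
    · have : (0:ℝ) < ((slots j).m 1 : ℝ) ^ 2 := by
        have : ((slots j).m 1 : ℝ) ≠ 0 := by exact_mod_cast h0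
        positivity
      nlinarith [sq_nonneg ((slots j).m 0 : ℝ), sq_nonneg ((slots j).m 2 : ℝ)]
    · have : (0:ℝ) < ((slots j).m 2 : ℝ) ^ 2 := by
        have : ((slots j).m 2 : ℝ) ≠ 0 := by exact_mod_cast h0
        positivity
      nlinarith [sq_nonneg ((slots j).m 0 : ℝ), sq_nonneg ((slots j).m 1 : ℝ)]
  have he : ∀ a, (cubatureWord.phase j).e a = (1 / Real.sqrt (slots j).n) * ((slots j).v a : ℝ) := by
    intro a
    show ((1 / Real.sqrt (slots j).n) • Torus.latticeVec (slots j).v) a = _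
    rw [PiLp.smul_apply, smul_eq_mul, Torus.latticeVec_apply]
  have hsum : ∑ a, (cubatureWord.phase j).e a * k a =
      (1 / Real.sqrt (slots j).n) * (((slots j).v 0 : ℝ) * k 0 + (slots j).v 1 * k 1 + (slots j).v 2 * k 2) := by
    simp only [Fin.sum_univ_three, he]; ring
  rw [hsum]
  unfold slotCoef kCoef
  rw [period_cubatureWord]
  show ((slots j).τ : ℝ) / (2 * (2 * π * ‖Torus.latticeVec (slots j).m‖) ^ 4) / 3720 * _ = _
  exact coef_algebra _ ‖Torus.latticeVec (slots j).m‖ (Mq (slots j)) (Real.sqrt (slots j).n) (slots j).n _ (2 * π) hM2 hMpos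
    (Real.sq_sqrt hn.le) hn (by positivity)

/-- THE 26-SLOT SUM AS AN INVARIANT FORM, for arbitrary class constants (frame completeness + cubature geometry, by `ring`). [folklore] -/
theorem slot_sum_poly (A1 A2 A3 B2 : ℝ) (k p : Fin 3 → ℝ) :
    ∑ j, kCoef (slots j) k * (qLag A1 A2 A3 (Mq (slots j)) * PpM (slots j) p + B2 * ((Mq (slots j) - 1) * (3 - Mq (slots j))) * Zf (slots j) p)
      = (80 * A1 + 192 * A2 + 144 * A3 + 64 * B2) * I1 k p + (40 * A1 + 160 * A2 + 144 * A3 + 32 * B2) * I2 k p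
        + (64 * A2 + 72 * A3) * I3 k p := by
  simp only [Fin.sum_univ_succ, Fin.sum_univ_zero, slots, kCoef, qLag, PpM, Zf, Mq, I1, I2, I3, Matrix.cons_val_zero, Matrix.cons_val_succ,
    Matrix.cons_val_one, Matrix.head_cons, Matrix.cons_val_two, Matrix.tail_cons]
  push_cast
  field_simp
  ring

/-- `sum_kCoef_uForm` (E1-CERT v2 spine §0–§2, p5 g12). -/
theorem sum_kCoef_uForm (k p : Fin 3 → ℝ) : ∑ j, kCoef (slots j) k * uForm (slots j) p = u1 * I1 k p + u2 * I2 k p + u3 * I3 k p := by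
  simp only [uForm, u1, u2, u3]; exact slot_sum_poly qA1 qA2 qA3 qB2 k p

/-- `sum_kCoef_lForm` (E1-CERT v2 spine §0–§2, p5 g12). -/
theorem sum_kCoef_lForm (k p : Fin 3 → ℝ) : ∑ j, kCoef (slots j) k * lForm (slots j) p = l1 * I1 k p + l2 * I2 k p + l3 * I3 k p := by
  simp only [lForm, l1, l2, l3]; exact slot_sum_poly lA1 lA2 lA3 lB2 k p



/-! ## Hoisted definitions of §3 (symmetrisation, class relaxations, slot geometry, {110} frame) -/

/-- the major-symmetrised tensor `½(S + Sᵀ)` (`Sᵀ i a j b = S j b i a`). -/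
def symS (S : T4) : T4 := (1 / 2 : ℝ) • (S + Torus.majorTranspose S)

/-- slot relaxation numbers `T_c = 4π²|m_c|²·M_B·τ_c` of the three classes and the {111} centre eigenvalue `β₁₁₁ = 1 + κc/3`. -/
def T100 : ℝ := 4 * π ^ 2 * 1 * MB * 40
/-- `T110` (E1-CERT v2 spine §0–§2, p5 g12). -/
def T110 : ℝ := 4 * π ^ 2 * 2 * MB * 128
/-- `T111` (E1-CERT v2 spine §0–§2, p5 g12). -/
def T111 : ℝ := 4 * π ^ 2 * 3 * MB * 243
/-- `β111` (E1-CERT v2 spine §0–§2, p5 g12). -/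
def β111 : ℝ := 1 + κc / 3

/-- the unit wave vector of slot `j`. -/
def nj (j : Fin 26) : Fin 3 → ℝ := mhat (cubatureWord.phase j)
/-- the relaxation number `T_j = 4π²|m_j|² M_B τ_j` of slot `j`. -/
def Tj (j : Fin 26) : ℝ := 4 * π ^ 2 * Mq (slots j) * MB * (slots j).τ
/-- `m·w`, `|w|²`, `Σ_c m_c² w_c²`. -/
def mdot (d : SlotData) (w : Fin 3 → ℝ) : ℝ := (d.m 0 : ℝ) * w 0 + d.m 1 * w 1 + d.m 2 * w 2
/-- `nsq` (E1-CERT v2 spine §0–§2, p5 g12). -/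
def nsq (w : Fin 3 → ℝ) : ℝ := w 0 ^ 2 + w 1 ^ 2 + w 2 ^ 2
/-- `I1m` (E1-CERT v2 spine §0–§2, p5 g12). -/
def I1m (d : SlotData) (w : Fin 3 → ℝ) : ℝ := (d.m 0 : ℝ) ^ 2 * w 0 ^ 2 + (d.m 1 : ℝ) ^ 2 * w 1 ^ 2 + (d.m 2 : ℝ) ^ 2 * w 2 ^ 2

/-- frame data of a slot: `z_c = 1 − m_c²` (the coordinate axis `⊥ m` for a face diagonal), `dv = z × m`. -/
def zv (d : SlotData) : Fin 3 → ℝ := fun c => 1 - (d.m c : ℝ) ^ 2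
/-- `zd` (E1-CERT v2 spine §0–§2, p5 g12). -/
def zd (d : SlotData) (w : Fin 3 → ℝ) : ℝ := zv d 0 * w 0 + zv d 1 * w 1 + zv d 2 * w 2
/-- `dd` (E1-CERT v2 spine §0–§2, p5 g12). -/
def dd (d : SlotData) (w : Fin 3 → ℝ) : ℝ :=
  (zv d 1 * d.m 2 - zv d 2 * d.m 1) * w 0 + (zv d 2 * d.m 0 - zv d 0 * d.m 2) * w 1 + (zv d 0 * d.m 1 - zv d 1 * d.m 0) * w 2

end Summit.AnomalousDissipation.AnomalousDissipation.Theorems.SolenoidalFractalHomogenisation.LagrangianStep.WEvenCert
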